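import Summits.Ventures.LatticeQCDFlow.Scaling.LazyCollectorFloor
import Summits.Ventures.LatticeQCDFlow.Scaling.HubCollectorLaw
import Summits.Ventures.LatticeQCDFlow.Scaling.HubListCurrencies

/-!
HONEST FRAMING: exact (Metropolis-corrected) sampling algorithms for lattice gauge theory; figures
of merit are autocorrelation/cost numbers at stated couplings and volumes; no continuum-physics
claim.

# LazyHubWindow — THE COLD-START WINDOW OF THE LAZY HUB: FOR EVERY HUB LIST, ALLOCATION AND MAPS THE LAZY EXCHANGE
# SCHEME NEEDS `t_mix^{lazy}(ε) ≥ (2K/θ_Σ − 1)·log(K·η)` STEPS FROM A RARE COLD START (`θ_Σ = t + (1−t)(1−w_0)`),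
# AND UNDER ONE-SIDED DOMINATION (CHAPTER K) IT NEEDS AT MOST `⌈(2/C)(½log(1/m₀^{K+1}) + log(1/(2ε)))⌉`,
# `C = p·min{t·c/(6m), γ₀(1−t)w_0/(14K)}`: ORDER `K·log K ≲ t_mix^{lazy} ≲ K²·log(1/m₀)` (lean-2 GEN-24, ours)

Venture-side (OURS).  Cell `lqcd-flow` (pub-lqcd), unit `pub-lqcd-lean-2-g24`, 2026-08-27.  Chapter L (the coupon-collector
law from a cold start), file 7.  The lazy version `(I + P)/2` of the hub-list exchange scheme
`P = t·ptGraphSwap μ e φ + (1−t)·prodKernel w M`, `e_r = (0, κ_r + 1)` (`Scaling/HubCollectorLaw`), seen through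
`Scaling/LazyCollectorFloor` (laziness = an idle move of weight `1/2`; the cold touch rates `θ_{k+1} = t·c_k/m + (1−t)w_{k+1}`
are halved, their sum is `θ_Σ/2`), and set against the lazy mixing-time CEILING of `Scaling/HubListCurrencies` (K6,
`multiHub_mixingTime_le`: identity maps, every hub edge listed `≥ c ≥ 1` times, hot weight `w_0 > 0`, one-sided
domination `p·μ_{k+1} ≤ μ_0`, hot Poincaré constant `γ₀`, `μ ≥ m₀` pointwise).

## What is proved

* §1 any swap list: `lazyScheme_touchSum_eq` (halved rates `(t·deg(k)/m + (1−t)w_k)/2` in closed form),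
  **`lazyScheme_worstTvDist_ge`** (`d^{lazy}(n) ≥ 1 − 1/Σ_{k∈T}(1−θ_k/2)ⁿ − Σ_{k∈T}μ_k(x_k)`), **`lazyScheme_lt_mixingTime`**.
* §2 hub lists: `lazyHub_touchRate_le_one`, `lazyHub_touchRate_total` (`Σ_k θ_{k+1}/2 = θ_Σ/2`);
  **`lazyHub_mixingTime_ge` (THE LAZY HUB COLLECTOR LAW)** — `K, m ≥ 1`, `0 ≤ t ≤ 1`, `θ_Σ > 0`, a configuration `x`
  with `Σ_k μ_{k+1}(x_{k+1}) ≤ δ`, `0 < η`, `ε < 1 − η − δ`, the lazy scheme `ε`-close to `π̃` at some time: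
  **`t_mix^{lazy}(ε) ≥ (2K/θ_Σ − 1)·log(K·η)`**; `lazyHub_mixingTime_ge_quarter` — **`≥ (2K/θ_Σ − 1)·log(K/4)`**.
* §3 **`lazyHub_mixingTime_window` (THE WINDOW)** — identity maps, the hypotheses of K6's ceiling, a rare cold start and
  the lazy scheme `1/4`-close at some time:
  **`(2K/θ_Σ − 1)·log(K/4) ≤ t_mix^{lazy}(1/4) ≤ ⌈(2/(p·min{t·c/(6m), γ₀(1−t)w_0/(14K)}))·(log(1/m₀^{K+1})/2 + log 2)⌉`**.

Reading (no numerics implied): for the lazy hub with one-sided domination the cold-start mixing time is pinned between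
order `K·log K` (every cold replica must be proposed) and order `K·(K+1)·log(1/m₀)` (relaxation time `≈ K` times the
log of the smallest stationary atom): the remaining gap is the usual `log(1/π_min)` versus `log K` slack of spectral
mixing bounds, not a gap in the exponent of `K` beyond one.  NOT CLAIMED: which end is the truth; non-lazy ceilings;
continuous spaces; anything measured.  Literature grade (cell rule): OWN COMPOSITION (chapter L files 3–6 + chapter K
file 6); nothing cited as a fact; no new bib keys.
-/

noncomputable section

open Finset Function
open Literature.Probability.MarkovChains

namespace Summit.Ventures.LatticeQCDFlow.Scaling

variable {S : Type*} [Fintype S] [DecidableEq S] {K m : ℕ} {μ : Fin (K + 1) → S → ℝ}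
  {M : Fin (K + 1) → S → S → ℝ} {w : Fin (K + 1) → ℝ} {t : ℝ} {e : Fin m → Fin (K + 1) × Fin (K + 1)}
  {φ : Fin m → Equiv.Perm S}

/-! ## §1 The lazy exchange scheme on any swap list -/

omit [Fintype S] [DecidableEq S] in
/-- The lazy touch sum in closed form: rates `(t·deg(k)/m + (1−t)·w_k)/2`. [ours] -/
theorem lazyScheme_touchSum_eq (T : Finset (Fin (K + 1))) (n : ℕ) :
    ∑ k ∈ T, (1 - ∑ o ∈ univ.filter (fun o : Option (Fin m ⊕ Fin (K + 1)) => k ∈ Option.elim o (∅ : Finset (Fin (K + 1)))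
        (Sum.elim (fun r => ({(e r).1, (e r).2} : Finset (Fin (K + 1)))) (fun j => {j}))),
      Option.elim o ((1 : ℝ) / 2) (fun a => Sum.elim (fun _ : Fin m => t / m) (fun j => (1 - t) * w j) a / 2)) ^ n
      = ∑ k ∈ T, (1 - (t * ((univ.filter fun r : Fin m => (e r).1 = k ∨ (e r).2 = k).card : ℝ) / m
          + (1 - t) * w k) / 2) ^ n :=
  sum_congr rfl fun k _ => by rw [lazy_touchRate, exchangeScheme_touchRate (e := e) (w := w) (t := t) k]

/-- **`d^{lazy}(n) ≥ 1 − 1/Σ_{k∈T}(1 − θ_k/2)ⁿ − Σ_{k∈T} μ_k(x_k)`** for the lazy exchange scheme on any list, any start `x`,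
any set `T` of levels no entry joins (`θ_k = t·deg(k)/m + (1−t)·w_k`). [ours] -/
theorem lazyScheme_worstTvDist_ge (hm : 1 ≤ m) (he : ∀ r, (e r).1 ≠ (e r).2) (hμ : ∀ k x, 0 < μ k x)
    (hμ1 : ∀ k, ∑ u, μ k u = 1) (hM : ∀ k, IsRowStochastic (M k)) (hw0 : ∀ k, 0 ≤ w k) (hw1 : ∑ k, w k = 1)
    (ht0 : 0 ≤ t) (ht1 : t ≤ 1) (x : Fin (K + 1) → S) (T : Finset (Fin (K + 1)))
    (hT : ∀ r, ¬((e r).1 ∈ T ∧ (e r).2 ∈ T)) (n : ℕ)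
    (hs : 0 < ∑ k ∈ T, (1 - (t * ((univ.filter fun r : Fin m => (e r).1 = k ∨ (e r).2 = k).card : ℝ) / m
          + (1 - t) * w k) / 2) ^ n) :
    1 - 1 / (∑ k ∈ T, (1 - (t * ((univ.filter fun r : Fin m => (e r).1 = k ∨ (e r).2 = k).card : ℝ) / m
          + (1 - t) * w k) / 2) ^ n) - ∑ k ∈ T, μ k (x k)
      ≤ worstTvDist (lazyVersion (fun y z : Fin (K + 1) → S => t * ptGraphSwap μ e φ y z + (1 - t) * prodKernel w M y z))
          (tensorFun μ) n := by
  have hB := tensorFun_mass_someKept_le hμ hμ1 x T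
  have hsum := lazyScheme_touchSum_eq (e := e) (w := w) (t := t) T n
  have hs' := hs
  rw [← hsum] at hs'
  have h := worstTvDist_ge_collector (lazy_weights_nonneg (exchangeScheme_weights_nonneg (m := m) hw0 ht0 ht1))
    (lazy_weights_sum (exchangeScheme_weights_sum (t := t) hm hw1))
    (lazy_kernels_isRowStochastic (exchangeScheme_kernels_isRowStochastic (φ := φ) he hμ hM))
    (lazy_kernels_local (exchangeScheme_kernels_local (μ := μ) (M := M) (φ := φ) he))
    (fun y z => lazyVersion_eq_mixture
      (fun y z => exchangeScheme_eq_mixture (M := M) (w := w) (t := t) (φ := φ) hm he hμ y z) y z)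
    (sum_tensorFun_eq_one μ hμ1) x T (lazy_independent (exchangeScheme_independent hT)) n hs'
  rw [hsum] at h
  have h' : 1 - 1 / (∑ k ∈ T, (1 - (t * ((univ.filter fun r : Fin m => (e r).1 = k ∨ (e r).2 = k).card : ℝ) / m
          + (1 - t) * w k) / 2) ^ n) - ∑ z ∈ univ.filter (fun z : Fin (K + 1) → S => ∃ k ∈ T, z k = x k), tensorFun μ z
      ≤ worstTvDist (lazyVersion (fun y z : Fin (K + 1) → S =>
          t * ptGraphSwap μ e φ y z + (1 - t) * prodKernel w M y z)) (tensorFun μ) n := by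
    convert h
  linarith

/-- **`n < t_mix^{lazy}(ε)` whenever `ε < 1 − 1/Σ_{k∈T}(1 − θ_k/2)ⁿ − Σ_{k∈T} μ_k(x_k)`** (reversible updates, the lazy
scheme `ε`-close to `π̃` at some time). [ours] -/
theorem lazyScheme_lt_mixingTime (hm : 1 ≤ m) (he : ∀ r, (e r).1 ≠ (e r).2) (hμ : ∀ k x, 0 < μ k x)
    (hμ1 : ∀ k, ∑ u, μ k u = 1) (hM : ∀ k, IsRowStochastic (M k)) (hMrev : ∀ k, DetailedBalance (μ k) (M k))
    (hw0 : ∀ k, 0 ≤ w k) (hw1 : ∑ k, w k = 1) (ht0 : 0 ≤ t) (ht1 : t ≤ 1) (x : Fin (K + 1) → S)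
    (T : Finset (Fin (K + 1))) (hT : ∀ r, ¬((e r).1 ∈ T ∧ (e r).2 ∈ T)) (n : ℕ)
    (hs : 0 < ∑ k ∈ T, (1 - (t * ((univ.filter fun r : Fin m => (e r).1 = k ∨ (e r).2 = k).card : ℝ) / m
          + (1 - t) * w k) / 2) ^ n) {ε : ℝ}
    (hε : ε < 1 - 1 / (∑ k ∈ T, (1 - (t * ((univ.filter fun r : Fin m => (e r).1 = k ∨ (e r).2 = k).card : ℝ) / m
          + (1 - t) * w k) / 2) ^ n) - ∑ k ∈ T, μ k (x k))
    (hmix : ∃ t₀, worstTvDist (lazyVersion (fun y z : Fin (K + 1) → S =>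
      t * ptGraphSwap μ e φ y z + (1 - t) * prodKernel w M y z)) (tensorFun μ) t₀ ≤ ε) :
    n < mixingTime (lazyVersion (fun y z : Fin (K + 1) → S => t * ptGraphSwap μ e φ y z + (1 - t) * prodKernel w M y z))
      (tensorFun μ) ε := by
  have hP := weightedScheme_isRowStochastic (t := t) (w := w) (ptGraphSwap_isRowStochastic (e := e) (φ := φ) hμ) hM
    hw0 hw1 ht0 ht1
  have hst := (weightedScheme_detailedBalance (w := w) (ptGraphSwap_detailedBalance (e := e) (φ := φ) hμ) hMrev t).isStationary
    hP.2
  by_contra hn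
  push Not at hn
  obtain ⟨t₀, ht₀⟩ := hmix
  have hd := worstTvDist_le_of_mixingTime_le (lazyVersion_isRowStochastic hP) (isStationary_lazyVersion hst) ht₀ hn
  linarith [lazyScheme_worstTvDist_ge (φ := φ) hm he hμ hμ1 hM hw0 hw1 ht0 ht1 x T hT n hs]

/-! ## §2 The lazy hub collector law -/

section LazyHub
variable (κ : Fin m → Fin K) (φ : Fin m → Equiv.Perm S)

omit [Fintype S] [DecidableEq S] in
/-- Every halved touch rate of a cold level is `≤ 1`. [ours] -/
theorem lazyHub_touchRate_le_one (hm : 1 ≤ m) (hw0 : ∀ k, 0 ≤ w k) (hw1 : ∑ k, w k = 1) (ht0 : 0 ≤ t) (ht1 : t ≤ 1)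
    (k : Fin K) : (t * ((univ.filter (fun r : Fin m => κ r = k)).card : ℝ) / m + (1 - t) * w k.succ) / 2 ≤ 1 := by
  have hmpos : (0 : ℝ) < m := Nat.cast_pos.mpr (by omega)
  have hc : ((univ.filter (fun r : Fin m => κ r = k)).card : ℝ) ≤ m := by
    have := Finset.card_filter_le (univ : Finset (Fin m)) (fun r => κ r = k)
    rw [card_univ, Fintype.card_fin] at this; exact_mod_cast this
  have hwk : w k.succ ≤ 1 := by rw [← hw1]; exact Finset.single_le_sum (fun j _ => hw0 j) (mem_univ _)
  have h1 : t * ((univ.filter (fun r : Fin m => κ r = k)).card : ℝ) / m ≤ t := by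
    rw [mul_div_assoc]; exact mul_le_of_le_one_right ht0 ((div_le_one hmpos).mpr hc)
  nlinarith [mul_le_mul_of_nonneg_left hwk (by linarith : (0 : ℝ) ≤ 1 - t)]

omit [Fintype S] [DecidableEq S] in
/-- **The halved cold touch rates sum to `θ_Σ/2`.** [ours] -/
theorem lazyHub_touchRate_total (hm : 1 ≤ m) (hw1 : ∑ k, w k = 1) :
    ∑ k : Fin K, (t * ((univ.filter (fun r : Fin m => κ r = k)).card : ℝ) / m + (1 - t) * w k.succ) / 2
      = (t + (1 - t) * (1 - w 0)) / 2 := by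
  rw [← Finset.sum_div, hubList_touchRate_sum κ hm hw1]

/-- **THE LAZY HUB COLLECTOR LAW:** on ANY hub list with ANY maps, ANY allocation and `μ_k`-reversible updates
(`K, m ≥ 1`, `0 ≤ t ≤ 1`, `θ_Σ = t + (1−t)(1−w_0) > 0`), from a configuration `x` with `Σ_k μ_{k+1}(x_{k+1}) ≤ δ`, for
`0 < η` and `ε < 1 − η − δ`, if the LAZY scheme is `ε`-close to `π̃` at some time:
**`t_mix^{lazy}(ε) ≥ (2K/θ_Σ − 1)·log(K·η)`**. [ours] -/
theorem lazyHub_mixingTime_ge (hK : 1 ≤ K) (hm : 1 ≤ m) (hμ : ∀ k x, 0 < μ k x) (hμ1 : ∀ k, ∑ u, μ k u = 1)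
    (hM : ∀ k, IsRowStochastic (M k)) (hMrev : ∀ k, DetailedBalance (μ k) (M k)) (hw0 : ∀ k, 0 ≤ w k)
    (hw1 : ∑ k, w k = 1) (ht0 : 0 ≤ t) (ht1 : t ≤ 1) (hθpos : 0 < t + (1 - t) * (1 - w 0))
    (x : Fin (K + 1) → S) {η δ ε : ℝ} (hη : 0 < η) (hδ : ∑ k : Fin K, μ k.succ (x k.succ) ≤ δ)
    (hgap : ε < 1 - η - δ)
    (hmix : ∃ t₀, worstTvDist (lazyVersion (fun y z : Fin (K + 1) → S =>
      t * ptGraphSwap μ (fun r : Fin m => (((0 : Fin (K + 1)), (κ r).succ) : Fin (K + 1) × Fin (K + 1))) φ y z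
        + (1 - t) * prodKernel w M y z)) (tensorFun μ) t₀ ≤ ε) :
    (2 * (K : ℝ) / (t + (1 - t) * (1 - w 0)) - 1) * Real.log (K * η)
      ≤ (mixingTime (lazyVersion (fun y z : Fin (K + 1) → S =>
          t * ptGraphSwap μ (fun r : Fin m => (((0 : Fin (K + 1)), (κ r).succ) : Fin (K + 1) × Fin (K + 1))) φ y z
            + (1 - t) * prodKernel w M y z)) (tensorFun μ) ε : ℝ) := by
  set n := mixingTime (lazyVersion (fun y z : Fin (K + 1) → S =>
      t * ptGraphSwap μ (fun r : Fin m => (((0 : Fin (K + 1)), (κ r).succ) : Fin (K + 1) × Fin (K + 1))) φ y z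
        + (1 - t) * prodKernel w M y z)) (tensorFun μ) ε with hn_def
  by_contra h
  push Not at h
  have hKpos : (0 : ℝ) < K := Nat.cast_pos.mpr (by omega)
  have hne : (univ : Finset (Fin K)).Nonempty := Finset.univ_nonempty_iff.mpr ⟨⟨0, by omega⟩⟩
  -- the closed-form touch sum over `Fin K` is at least `1/η`
  have hθle1 : t + (1 - t) * (1 - w 0) ≤ 1 := by nlinarith [hw0 0]
  have hΘT : (t + (1 - t) * (1 - w 0)) / 2 < ((univ : Finset (Fin K)).card : ℝ) := by
    rw [card_univ, Fintype.card_fin]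
    have : (1 : ℝ) ≤ K := by exact_mod_cast hK
    linarith
  have hn' : (n : ℝ) ≤ ((((univ : Finset (Fin K)).card : ℝ)) / ((t + (1 - t) * (1 - w 0)) / 2) - 1)
      * Real.log (((univ : Finset (Fin K)).card : ℝ) * η) := by
    rw [card_univ, Fintype.card_fin]
    have e1 : (K : ℝ) / ((t + (1 - t) * (1 - w 0)) / 2) = 2 * K / (t + (1 - t) * (1 - w 0)) := by field_simp
    rw [e1]; exact h.le
  have hsge := touchSum_ge_of_sum_le_log (univ : Finset (Fin K)) hne
    (fun j => (t * ((univ.filter (fun r : Fin m => κ r = j)).card : ℝ) / m + (1 - t) * w j.succ) / 2)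
    (fun j _ => lazyHub_touchRate_le_one κ hm hw0 hw1 ht0 ht1 j) (by positivity) hΘT
    (le_of_eq (lazyHub_touchRate_total κ hm hw1)) hη hn'
  have hspos : 0 < ∑ j : Fin K,
      (1 - (t * ((univ.filter (fun r : Fin m => κ r = j)).card : ℝ) / m + (1 - t) * w j.succ) / 2) ^ n :=
    lt_of_lt_of_le (by positivity) hsge
  have h1s : 1 / (∑ j : Fin K,
      (1 - (t * ((univ.filter (fun r : Fin m => κ r = j)).card : ℝ) / m + (1 - t) * w j.succ) / 2) ^ n) ≤ η := by
    rw [one_div_le hspos hη]; exact hsge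
  -- the cold levels as a set no entry joins
  set T : Finset (Fin (K + 1)) := (univ : Finset (Fin K)).image Fin.succ with hT_def
  have hinj : Set.InjOn (Fin.succ : Fin K → Fin (K + 1)) ((univ : Finset (Fin K)) : Set (Fin K)) :=
    fun a _ b _ hab => Fin.succ_inj.mp hab
  have hsumT : ∑ k ∈ T, (1 - (t * ((univ.filter fun r : Fin m =>
        ((fun r : Fin m => (((0 : Fin (K + 1)), (κ r).succ) : Fin (K + 1) × Fin (K + 1))) r).1 = k ∨
        ((fun r : Fin m => (((0 : Fin (K + 1)), (κ r).succ) : Fin (K + 1) × Fin (K + 1))) r).2 = k).card : ℝ) / m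
          + (1 - t) * w k) / 2) ^ n
      = ∑ j : Fin K, (1 - (t * ((univ.filter (fun r : Fin m => κ r = j)).card : ℝ) / m + (1 - t) * w j.succ) / 2) ^ n := by
    rw [hT_def, Finset.sum_image hinj]
    exact sum_congr rfl fun k _ => by rw [hubList_degree_succ κ k]
  have hmassT : ∑ k ∈ T, μ k (x k) = ∑ k : Fin K, μ k.succ (x k.succ) := by rw [hT_def, Finset.sum_image hinj]
  have hs' : 0 < ∑ k ∈ T, (1 - (t * ((univ.filter fun r : Fin m =>
        ((fun r : Fin m => (((0 : Fin (K + 1)), (κ r).succ) : Fin (K + 1) × Fin (K + 1))) r).1 = k ∨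
        ((fun r : Fin m => (((0 : Fin (K + 1)), (κ r).succ) : Fin (K + 1) × Fin (K + 1))) r).2 = k).card : ℝ) / m
          + (1 - t) * w k) / 2) ^ n := by rw [hsumT]; exact hspos
  have hε' : ε < 1 - 1 / (∑ k ∈ T, (1 - (t * ((univ.filter fun r : Fin m =>
        ((fun r : Fin m => (((0 : Fin (K + 1)), (κ r).succ) : Fin (K + 1) × Fin (K + 1))) r).1 = k ∨
        ((fun r : Fin m => (((0 : Fin (K + 1)), (κ r).succ) : Fin (K + 1) × Fin (K + 1))) r).2 = k).card : ℝ) / m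
          + (1 - t) * w k) / 2) ^ n) - ∑ k ∈ T, μ k (x k) := by
    rw [hsumT, hmassT]; linarith
  have key := lazyScheme_lt_mixingTime (φ := φ) hm (hubList_fst_ne_snd κ) hμ hμ1 hM hMrev hw0 hw1 ht0 ht1 x T
    (hubList_cold_independent κ) n hs' hε' hmix
  exact lt_irrefl _ key

/-- **THE LAZY QUARTER LAW: `t_mix^{lazy}(1/4) ≥ (2K/θ_Σ − 1)·log(K/4)`.** [ours] -/
theorem lazyHub_mixingTime_ge_quarter (hK : 1 ≤ K) (hm : 1 ≤ m) (hμ : ∀ k x, 0 < μ k x)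
    (hμ1 : ∀ k, ∑ u, μ k u = 1) (hM : ∀ k, IsRowStochastic (M k)) (hMrev : ∀ k, DetailedBalance (μ k) (M k))
    (hw0 : ∀ k, 0 ≤ w k) (hw1 : ∑ k, w k = 1) (ht0 : 0 ≤ t) (ht1 : t ≤ 1) (hθpos : 0 < t + (1 - t) * (1 - w 0))
    (x : Fin (K + 1) → S) (hx : ∑ k : Fin K, μ k.succ (x k.succ) ≤ 1 / 4)
    (hmix : ∃ t₀, worstTvDist (lazyVersion (fun y z : Fin (K + 1) → S =>
      t * ptGraphSwap μ (fun r : Fin m => (((0 : Fin (K + 1)), (κ r).succ) : Fin (K + 1) × Fin (K + 1))) φ y z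
        + (1 - t) * prodKernel w M y z)) (tensorFun μ) t₀ ≤ 1 / 4) :
    (2 * (K : ℝ) / (t + (1 - t) * (1 - w 0)) - 1) * Real.log (K / 4)
      ≤ (mixingTime (lazyVersion (fun y z : Fin (K + 1) → S =>
          t * ptGraphSwap μ (fun r : Fin m => (((0 : Fin (K + 1)), (κ r).succ) : Fin (K + 1) × Fin (K + 1))) φ y z
            + (1 - t) * prodKernel w M y z)) (tensorFun μ) (1 / 4) : ℝ) := by
  have h := lazyHub_mixingTime_ge κ φ hK hm hμ hμ1 hM hMrev hw0 hw1 ht0 ht1 hθpos x (η := 1 / 4) (by norm_num) hx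
    (by norm_num : (1 : ℝ) / 4 < 1 - 1 / 4 - 1 / 4) hmix
  rwa [mul_one_div] at h

end LazyHub

/-! ## §3 The window -/

/-- **THE COLD-START WINDOW OF THE LAZY HUB (identity maps, one-sided domination):** every hub edge listed `≥ c ≥ 1`
times, hot weight `w_0 > 0`, `0 < t < 1`, `p·μ_{k+1} ≤ μ_0`, hot Poincaré constant `γ₀`, `μ ≥ m₀ > 0` pointwise, a
configuration `x` with `Σ_k μ_{k+1}(x_{k+1}) ≤ 1/4`, the lazy scheme `1/4`-close at some time:
**`(2K/θ_Σ − 1)·log(K/4) ≤ t_mix^{lazy}(1/4) ≤ ⌈(2/(p·min{t·c/(6m), γ₀(1−t)w_0/(14K)}))·(log(1/m₀^{K+1})/2 + log 2)⌉`**.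
[ours] -/
theorem lazyHub_mixingTime_window [Nontrivial S] (κ : Fin m → Fin K) (hK : 1 ≤ K) (hm : 1 ≤ m) {c : ℕ}
    (hc : ∀ k : Fin K, c ≤ (univ.filter (fun r : Fin m =>
      (fun r : Fin m => (((0 : Fin (K + 1)), (κ r).succ) : Fin (K + 1) × Fin (K + 1))) r = ((0 : Fin (K + 1)), k.succ))).card)
    (hc1 : 1 ≤ c) (hμ : ∀ k x, 0 < μ k x) (hμ1 : ∀ k, ∑ u, μ k u = 1) (hM : ∀ k, IsRowStochastic (M k))
    (hMrev : ∀ k, DetailedBalance (μ k) (M k)) (hM0 : IsIrreducible (M 0)) (hw0 : ∀ k, 0 ≤ w k)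
    (hw1 : ∑ k, w k = 1) (hwhot : 0 < w 0) (ht0 : 0 < t) (ht1 : t < 1) {p γ₀ : ℝ} (hp : 0 < p) (hp1 : p ≤ 1)
    (hγ₀ : 0 < γ₀) (hdom : ∀ (k : Fin K) (u : S), p * μ k.succ u ≤ μ 0 u)
    (hgap0 : ∀ h : S → ℝ, γ₀ * lawVariance (μ 0) h ≤ dirichletForm (μ 0) (M 0) h)
    {m₀ : ℝ} (hm₀ : 0 < m₀) (hμm : ∀ k x, m₀ ≤ μ k x)
    (x : Fin (K + 1) → S) (hx : ∑ k : Fin K, μ k.succ (x k.succ) ≤ 1 / 4)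
    (hmix : ∃ t₀, worstTvDist (lazyVersion (fun y z : Fin (K + 1) → S =>
      t * ptGraphSwap μ (fun r : Fin m => (((0 : Fin (K + 1)), (κ r).succ) : Fin (K + 1) × Fin (K + 1)))
        (fun _ : Fin m => Equiv.refl S) y z + (1 - t) * prodKernel w M y z)) (tensorFun μ) t₀ ≤ 1 / 4) :
    (2 * (K : ℝ) / (t + (1 - t) * (1 - w 0)) - 1) * Real.log (K / 4)
        ≤ (mixingTime (lazyVersion (fun y z : Fin (K + 1) → S =>
            t * ptGraphSwap μ (fun r : Fin m => (((0 : Fin (K + 1)), (κ r).succ) : Fin (K + 1) × Fin (K + 1)))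
              (fun _ : Fin m => Equiv.refl S) y z + (1 - t) * prodKernel w M y z)) (tensorFun μ) (1 / 4) : ℝ) ∧
      mixingTime (lazyVersion (fun y z : Fin (K + 1) → S =>
            t * ptGraphSwap μ (fun r : Fin m => (((0 : Fin (K + 1)), (κ r).succ) : Fin (K + 1) × Fin (K + 1)))
              (fun _ : Fin m => Equiv.refl S) y z + (1 - t) * prodKernel w M y z)) (tensorFun μ) (1 / 4)
        ≤ ⌈2 / (p * min (t * c / (6 * m)) (γ₀ * (1 - t) * w 0 / (14 * K)))
            * (Real.log (1 / m₀ ^ (K + 1)) / 2 + Real.log (1 / (2 * (1 / 4 : ℝ))))⌉₊ := by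
  have hθpos : 0 < t + (1 - t) * (1 - w 0) := by
    have : w 0 ≤ 1 := by rw [← hw1]; exact Finset.single_le_sum (fun j _ => hw0 j) (mem_univ _)
    nlinarith
  refine ⟨lazyHub_mixingTime_ge_quarter κ (fun _ => Equiv.refl S) hK hm hμ hμ1 hM hMrev hw0 hw1 ht0.le ht1.le hθpos
    x hx hmix, ?_⟩
  exact multiHub_mixingTime_le hK hm (hubList_fst_ne_snd κ) hc hc1 hμ hμ1 hM hMrev hM0 hw0 hw1 hwhot ht0 ht1 hp hp1
    hγ₀ hdom hgap0 hm₀ hμm (by norm_num) (by norm_num)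

end Summit.Ventures.LatticeQCDFlow.Scaling

end
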